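import Summits.QuantumFields.YangMills.Theorems.UnitScaleTiltProp7KinvConjugateDecay
import Summits.QuantumFields.YangMills.Theorems.UnitScaleTiltProp7QkWeightConjugation
import Summits.QuantumFields.YangMills.Theorems.UnitScaleTiltProp7BlockDistanceWeights
import HarnessLib

/-!
# Route `UnitScaleTilt`, crux K1 «MinimiserStabilityRegPr» (stmt-QuantumFields-19200), EX face — K137 STOREY, FILE (K2-KNIT):
# **THE COARSE ENTRY ROW OF `K⁻¹ = (Q_kGQ_k†)⁻¹` FROM TWO LETTERS** — the coercivity `m₀` of `K` on the class ((K1)'s output) and the conjugated-resolvent row `δ₃` of `G` over the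
# fine-Lipschitz phase class ((K2b-δ₃)'s output) — with the block-distance weights, the multipliers, `Q_k`'s weight conjugation (δ₁ = δ₂) and `Q_k†`'s norm DISCHARGED by name:
# the `hKinv` letter of the `hCk` door ✓`Prop7KernelCDoorOfKinvEntry.kernelC_of_kinvRow_of_greenColumn`, VERBATIM

Cell `ym3-torus` (HUMAN RULING D-0037; rung R3 = SU(2) YM₃ on T³ — NOT d = 4, NOT infinite volume, NOT a mass gap, NOT Clay).  Width seat `ym3-torus-px10` (gen 13; FREE px after
✓p768275∕✓p768476∕✓p768615); CLAIM 2026-08-30 10:16Z (first refusal px12 g17 ∕ px16 g13 ∕ px13 g15 ∕ ★p1 g27).  THEOREMS ONLY (0 `def`, 0 `sorry`, default heartbeats);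
`--supports stmt-QuantumFields-19200 --as helper`; count-neutral.

THE ROAD (LOCATE-K137 (K2), px12 g16): print [B9] (3.132) «|(QGQ*)⁻¹(y,y′)| ≤ O(1)…e^{−δ₁d(y,y′)}» DEFERS to [Balaban1984PropagatorsII] §2 — the conjugated-accretivity ∕ Combes–Thomas
argument for the coarse Gram operator.  The tree's engine is px12 g16 ✓`Prop7KinvConjugateDecay`: ★`conj_accretive_of_letters` (`(m₀ − R)‖Mu‖² ≤ re⟪Mu, M(Q_kGQ_k†u)⟫` from the
letters `m₀`, `C_Q`, `B_G`, `δ₁`, `δ₂`, `δ₃`) and ★`norm_symm_Kinv_single_le_of_conj_accretive` (`‖toL2B⁻¹(K⁻¹(toL2B δ_{y′}Z))(y)‖ ≤ √2·m⁻¹·(w y′∕w y)·‖Z‖`).  THIS FILE supplies, for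
EACH source coarse bond `y`, the weight and every letter the tree already holds: `φ_y` := px12 g13 ✓`exists_blockDistanceWeight` at `ŷ := siteShift … y.src` with slope `μη` (`φ = 0` on
`B(ŷ)`, `μ(tdist z ŷ − 3) ≤ φ` on `B(z)`); the coarse multipliers `M`∕`Mi` at `w c := e^{±φ(corner c)}` (px12 g17 ✓`exists_weightOpB`, corners ✓`iterBlockOf_src_corner`) and the fine
ones `Mf`∕`Mfi` at `e^{±φ∘src}` (A3 ✓`exists_smulBond`), inverse pairs by ✓`weightB_comp_apply`∕✓`weight_comp_apply`; δ₁ = δ₂ := px12 g17 ✓`qkWeightConj_letters_exp_corner_of_regPr`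
(`δ_Q = √(216(e^{μ(d+1)} − 1)²(cB∕(c₀ℓ³)))`); `C_Q` := ✓`norm_adjoint_Qk_le_of_regPr` (`6√(cB∕c₀)√(ℓ⁻³)`); `hadj` := `LinearMap.adjoint_inner_right`; `KK⁻¹ = 1` := ✓`Qk_GT_adjoint_KinvT`.
Then `w y = 1`, `w y′ ≥ e^{μ(tdist(ŷ′, ŷ) − 3)}` turn the engine's `w y∕w y′` into `e^{3μ}·e^{−μ·tdist(ŷ′, ŷ)}`.
THE DISPLAYED LETTERS.  (m₀) `hKco : ∀ c, m₀‖c‖² ≤ re⟪c, Q_k(G(Q_k†c))⟫` — the second conjunct of px12 ✓`Prop7KinvBoundOfInterpolant.norm_KinvT_le_of_interpolant_rows` VERBATIM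
(`m₀ = (4C₀)⁻¹`, modulo px13's (K1b-a) interpolant rows); (B_G) `hG : ∀ x, ‖Gx‖ ≤ B_G‖x‖` — ★p1 ✓`Prop7OneFormCoerciveHolds.norm_GT_le_of_coercive`; (δ₃) `hres` — ✓p767718's `hB` quantified
over the fine-Lipschitz phase class `|φ x − φ x′| ≤ μ·η·tdist x x′` and over multiplier pairs described by `φ` (px12 g17's (K2b-δ₃) target ✓`Prop7OneFormConjugateResolvent` + assembly); (R) ONE
real inequality `C_Q·B_G·δ_Q + C_Q·δ₃·(C_Q + δ_Q) + δ_Q·(B_G + δ₃)·(C_Q + δ_Q) ≤ m₀∕2` — K-FREE at the pins (`C_Q = 6`, `δ_Q = √216·(e^{4μ} − 1) → 0` with the slope `μ`).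
WHAT IS PROVED (ns `Summit.QuantumFields.YangMills.Theorems.Prop7KinvRowOfConjLetters`; member `F`, `n ≤ K`, weights `c₀ cB`, any slot `Δx`, any coupling `a`).
* §1 `exp_weight_rows` — the weight of a source bond: `e^{φ} = 1` on `B(ŷ)` and `e^{−3μ}·e^{μ·tdist(ŷ′,ŷ)} ≤ e^{φ}` on `B(ŷ′)` (so `w y∕w y′ ≤ e^{3μ}e^{−μ·tdist}` at the corners).
* §2 ★★★ `kinvRow_of_coercive_of_conjResolvent` — `RegPr F n K ε₀ U₀` + `10¹⁰L⁶ε₀ ≤ 1` + `10¹²L³ε₀ ≤ 1` + `PosOnto` + (m₀) + (B_G) + (δ₃) + (R) ⟹ **the `hKinv` TEXT**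
  `∀ y Z y′, ‖toL2B⁻¹(KinvT … a Δx U₀ (toL2B(δ_y Z)))(y′)‖ ≤ (√2·(m₀∕2)⁻¹·e^{3μ})·e^{−μ·tdist(siteShift y′.src, siteShift y.src)}·‖Z‖`.
* §3 (v1.1) ★★★ `kinvRow_family_of_coercive_of_conjResolvent` — the Idx edition: L-only letters (`m₀ L` at the scaling `(cB∕c₀)ℓ⁻³`, `BG L`, `δ₃ L`, slope `μ L`), thread `Λ`, cap windows,
  ONE L-only window (R_L) (the member (R) divided by `s = (cB∕c₀)ℓ⁻³`) ⟹ the doors' `hKinv` FAMILY TEXT with `CK L := 2√2e^{3μ L}∕m₀ L` at the scaling `(c₀∕cB)ℓ³`.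
HYP-SAT (★★OWNER №42).  (m₀), (B_G), (δ₃) are displayed rows in currencies of record with named suppliers ((K1) px12∕px13; (γ) ★p1; (K2b-δ₃) px12 g17), class (1); (R) a numeric window;
none restates the conclusion (an ENTRY row of `K⁻¹`; the letters are OPERATOR inequalities).  HONEST SCOPE.  Plumbing over the landed engine; no estimate of print is proved; nothing of
(3.132)'s inputs, `hCk`, EX or the crux is proved here; the Yang–Mills mass gap is NOT proved.

References: T. Bałaban, CMP **99** (1985) 389–434 [Balaban1985BackgroundPropagators] (Thm 3.1 (3.46) p.398, (3.49) p.399, (3.132) p.422); CMP **96** (1984) 223–250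
[Balaban1984PropagatorsII] (§2); CMP **98** (1985) 17–51 [Balaban1985Averaging] ((2) p.17).
-/

set_option autoImplicit false

noncomputable section

open scoped BigOperators Matrix.Norms.L2Operator InnerProductSpace ComplexConjugate

namespace Summit.QuantumFields.YangMills.Theorems.Prop7KinvRowOfConjLetters

open Literature.MathematicalPhysics.QuantumFieldTheory.Balaban1983to89
open Literature.MathematicalPhysics.QuantumFieldTheory.Balaban1983to89.T3ContinuumYM3Torus
open T3SectALandauChart (eta eta_pos)
open T3PrintedRegularMinimiser (RegPr)
open T3PrintedRegularOrbits (sites_eq)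
open T3LevelShift (siteShift bondShift bondShift_src)
open B9Eq311L2Pairing (WL2)
open B11Eq103H1Complex (BondL2K)
open B5Eq118OneStroke (iterBlockOf)
open Summit.QuantumFields.YangMills.Theorems.Prop7SectET3Transport (periodsT3)
open Summit.QuantumFields.YangMills.Theorems.Prop7SectET3HilbertLetters (W₂ toL2 toL2B)
open Summit.QuantumFields.YangMills.Theorems.Prop7SectET3CurvedPropagators (Qk GT KinvT PosOnto Qk_GT_adjoint_KinvT)
open Summit.QuantumFields.YangMills.Theorems.Prop7KinvConjugateDecay (conj_accretive_of_letters norm_symm_Kinv_single_le_of_conj_accretive)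
open Summit.QuantumFields.YangMills.Theorems.Prop7QkWeightConjugation (exists_weightOpB weightB_comp_apply weight_comp_apply norm_adjoint_Qk_le_of_regPr
  qkWeightConj_letters_exp_corner_of_regPr)
open Summit.QuantumFields.YangMills.Theorems.Prop7OneFormAgmon (exists_smulBond)
open Summit.QuantumFields.YangMills.Theorems.Prop7OneFormAgmonPhaseClass (iterBlockOf_src_corner)
open Summit.QuantumFields.YangMills.Theorems.Prop7BlockDistanceWeights (exists_blockDistanceWeight)

variable (F : T3Family) {n K : ℕ} (h : n ≤ K) (c₀ cB : ℝ) [Fact (0 < c₀)] [Fact (0 < cB)]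

/-! ## §1 The weight of a source bond, read at the block corners -/

omit [Fact (0 < c₀)] [Fact (0 < cB)] in
/-- **THE WEIGHT OF A SOURCE BOND**: for a phase `φ` vanishing on the block `ŷ` and bounded below by `μ(tdist z ŷ − 3)` on each block `z` (px12 g13's (iii)∕(iv)), `e^{φ} = 1` on `B(ŷ)` and
`e^{−3μ}·e^{μ·tdist(ŷ′, ŷ)} ≤ e^{φ}` on `B(ŷ′)` (read below at the block corners ✓`iterBlockOf_src_corner`). [cite: Balaban1985BackgroundPropagators, (3.46) p.398, (3.49) p.399; Balaban1985Averaging, (2) p.17] -/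
theorem exp_weight_rows (φ : Site (F.P K) 0 → ℝ) {μ : ℝ} (y : PBond (F.P n) 0)
    (hφy : ∀ x, iterBlockOf (K - n) x = siteShift (sites_eq F n K h) y.src → φ x = 0)
    (hφz : ∀ (z : Site (F.P K) (K - n)) (x : Site (F.P K) 0), iterBlockOf (K - n) x = z → μ * ((Site.tdist z (siteShift (sites_eq F n K h) y.src) : ℝ) - 3) ≤ φ x) :
    (∀ x : Site (F.P K) 0, iterBlockOf (K - n) x = siteShift (sites_eq F n K h) y.src → Real.exp (φ x) = 1) ∧
    (∀ (y' : PBond (F.P n) 0) (x : Site (F.P K) 0), iterBlockOf (K - n) x = siteShift (sites_eq F n K h) y'.src →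
      Real.exp (-(3 * μ)) * Real.exp (μ * (Site.tdist (P := F.P K) (siteShift (sites_eq F n K h) y'.src) (siteShift (sites_eq F n K h) y.src) : ℝ)) ≤ Real.exp (φ x)) := by
  refine ⟨fun x hx => by rw [hφy x hx, Real.exp_zero], fun y' x hx => ?_⟩
  rw [← Real.exp_add, Real.exp_le_exp]
  have hz := hφz (siteShift (sites_eq F n K h) y'.src) x hx
  linarith

/-! ## §2 ★★★ The entry row of `K⁻¹` from the coercivity of `K` and the conjugated-resolvent class row -/

/-- ★★★ **THE `hKinv` LETTER FROM `m₀` AND `δ₃`** (the (K2) knit at the member).  At a printed-regular background (`RegPr F n K ε₀ U₀`, windows `10¹⁰L⁶ε₀ ≤ 1`, `10¹²L³ε₀ ≤ 1`) on the class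
`PosOnto … a Δx U₀`, given (m₀) the coercivity of `K = Q_kGQ_k†`, (B_G) the norm of `G`, (δ₃) the conjugated-resolvent row of `G` over the fine-Lipschitz phase class of slope `μη`, and the
smallness (R) `C_Q·B_G·δ_Q + C_Q·δ₃·(C_Q+δ_Q) + δ_Q·(B_G+δ₃)·(C_Q+δ_Q) ≤ m₀∕2` with `C_Q := 6√(cB∕c₀)√(ℓ⁻³)`, `δ_Q := √(216(e^{μ(d+1)}−1)²(cB∕(c₀ℓ³)))`: for all coarse bonds `y, y′` and
`Z ∈ M₂(ℂ)`, `‖toL2B⁻¹(K⁻¹(toL2B(δ_y ⊗ Z)))(y′)‖ ≤ (√2·(m₀∕2)⁻¹·e^{3μ})·e^{−μ·tdist(ŷ′, ŷ)}·‖Z‖` — the `hKinv` text of ✓`kernelC_of_kinvRow_of_greenColumn`.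
[cite: Balaban1985BackgroundPropagators, (3.132) p.422, Thm 3.1 (3.46) p.398, (3.49) p.399; Balaban1984PropagatorsII, §2] -/
theorem kinvRow_of_coercive_of_conjResolvent {ε₀ : ℝ} (hε₀ : 0 < ε₀) (hε : 10 ^ 10 * (F.L : ℝ) ^ 6 * ε₀ ≤ 1) (hε12 : 10 ^ 12 * (F.L : ℝ) ^ 3 * ε₀ ≤ 1)
    (U₀ : GaugeField (F.P K) 0 (Matrix.specialUnitaryGroup (Fin 2) ℂ)) (hreg : RegPr F n K ε₀ U₀) (a : ℝ)
    (Δx : GaugeField (F.P K) 0 (Matrix.specialUnitaryGroup (Fin 2) ℂ) → (BondL2K ℂ 3 (periodsT3 F K) c₀ W₂ →ₗ[ℂ] BondL2K ℂ 3 (periodsT3 F K) c₀ W₂))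
    (hp : PosOnto F n K h c₀ cB a Δx U₀)
    {m₀ BG μ δ₃ : ℝ} (hm₀ : 0 < m₀) (hBG : 0 ≤ BG) (hμ : 0 ≤ μ) (hδ₃ : 0 ≤ δ₃)
    (hKco : ∀ c : WL2 ℂ (fun _ : PBond (F.P n) 0 => cB) W₂,
      m₀ * ‖c‖ ^ 2 ≤ RCLike.re ⟪c, Qk F n K h c₀ cB U₀ (GT F n K h c₀ cB a Δx U₀ (LinearMap.adjoint (Qk F n K h c₀ cB U₀) c))⟫_ℂ)
    (hG : ∀ x, ‖GT F n K h c₀ cB a Δx U₀ x‖ ≤ BG * ‖x‖)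
    (hres : ∀ φ : Site (F.P K) 0 → ℝ, (∀ x x' : Site (F.P K) 0, |φ x - φ x'| ≤ μ * eta F n K * (Site.tdist x x' : ℝ)) →
      ∀ (Mf Mfi : BondL2K ℂ 3 (periodsT3 F K) c₀ W₂ →ₗ[ℂ] BondL2K ℂ 3 (periodsT3 F K) c₀ W₂),
        (∀ X, Mf (toL2 F K c₀ X) = toL2 F K c₀ (fun b => Real.exp (φ b.src) • X b)) →
        (∀ X, Mfi (toL2 F K c₀ X) = toL2 F K c₀ (fun b => (Real.exp (φ b.src))⁻¹ • X b)) →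
        ∀ x, ‖Mf (GT F n K h c₀ cB a Δx U₀ (Mfi x)) - GT F n K h c₀ cB a Δx U₀ x‖ ≤ δ₃ * ‖x‖)
    (hR : (6 * Real.sqrt (cB / c₀) * Real.sqrt (((F.L : ℝ) ^ (K - n))⁻¹ ^ 3)) * BG * Real.sqrt (216 * (Real.exp (μ * ((F.P K).d + 1)) - 1) ^ 2 * (cB / (c₀ * ((F.L : ℝ) ^ (K - n)) ^ 3)))
          + (6 * Real.sqrt (cB / c₀) * Real.sqrt (((F.L : ℝ) ^ (K - n))⁻¹ ^ 3)) * δ₃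
              * ((6 * Real.sqrt (cB / c₀) * Real.sqrt (((F.L : ℝ) ^ (K - n))⁻¹ ^ 3)) + Real.sqrt (216 * (Real.exp (μ * ((F.P K).d + 1)) - 1) ^ 2 * (cB / (c₀ * ((F.L : ℝ) ^ (K - n)) ^ 3))))
          + Real.sqrt (216 * (Real.exp (μ * ((F.P K).d + 1)) - 1) ^ 2 * (cB / (c₀ * ((F.L : ℝ) ^ (K - n)) ^ 3))) * (BG + δ₃)
              * ((6 * Real.sqrt (cB / c₀) * Real.sqrt (((F.L : ℝ) ^ (K - n))⁻¹ ^ 3)) + Real.sqrt (216 * (Real.exp (μ * ((F.P K).d + 1)) - 1) ^ 2 * (cB / (c₀ * ((F.L : ℝ) ^ (K - n)) ^ 3))))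
        ≤ m₀ / 2) :
    ∀ (y : PBond (F.P n) 0) (Z : Matrix (Fin 2) (Fin 2) ℂ) (y' : PBond (F.P n) 0),
      ‖(toL2B F n cB).symm (KinvT F n K h c₀ cB a Δx U₀ (toL2B F n cB (Pi.single y Z))) y'‖
        ≤ (Real.sqrt 2 * (m₀ / 2)⁻¹ * Real.exp (3 * μ))
          * Real.exp (-(μ * (Site.tdist (P := F.P K) (siteShift (sites_eq F n K h) y'.src) (siteShift (sites_eq F n K h) y.src) : ℝ))) * ‖Z‖ := by
  classical
  intro y Z y'
  have hc₀ : 0 < c₀ := Fact.out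
  have hcB : 0 < cB := Fact.out
  -- abbreviations for the two discharged constants
  set CQ : ℝ := 6 * Real.sqrt (cB / c₀) * Real.sqrt (((F.L : ℝ) ^ (K - n))⁻¹ ^ 3) with hCQ
  set δQ : ℝ := Real.sqrt (216 * (Real.exp (μ * ((F.P K).d + 1)) - 1) ^ 2 * (cB / (c₀ * ((F.L : ℝ) ^ (K - n)) ^ 3))) with hδQ
  have hCQ0 : 0 ≤ CQ := by rw [hCQ]; positivity
  have hδQ0 : 0 ≤ δQ := by rw [hδQ]; positivity
  -- the block-distance phase of the SOURCE block `ŷ`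
  obtain ⟨φ, φc, -, -, hφ', -, hφy, hφz⟩ := exists_blockDistanceWeight F h (siteShift (sites_eq F n K h) y.src) hμ
  -- the corner weight and its two multipliers on each carrier
  let xr : PBond (F.P n) 0 → Site (F.P K) 0 := fun c =>
    Site.fibreSite 0 (K - n) (bondShift (sites_eq F n K h) c).src fun _ => (⟨0, pow_pos (F.P K).L_pos (K - n)⟩ : Fin ((F.P K).L ^ (K - n)))
  let w : PBond (F.P n) 0 → ℝ := fun c => Real.exp (φ (xr c))
  have hw : ∀ c, 0 < w c := fun c => Real.exp_pos _
  obtain ⟨M, hM⟩ := exists_weightOpB (F := F) (cB := cB) w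
  obtain ⟨Mi, hMi⟩ := exists_weightOpB (F := F) (cB := cB) (fun c => (w c)⁻¹)
  obtain ⟨Mf, hMf⟩ := exists_smulBond (F := F) (c₀ := c₀) (fun b : PBond (F.P K) 0 => Real.exp (φ b.src))
  obtain ⟨Mfi, hMfi⟩ := exists_smulBond (F := F) (c₀ := c₀) (fun b : PBond (F.P K) 0 => (Real.exp (φ b.src))⁻¹)
  have hMiM : ∀ c, Mi (M c) = c := weightB_comp_apply w (fun c => (w c)⁻¹) (fun c => inv_mul_cancel₀ (hw c).ne') M Mi hM hMi
  have hMfiMf : ∀ x, Mfi (Mf x) = x :=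
    weight_comp_apply (fun b => Real.exp (φ b.src)) (fun b => (Real.exp (φ b.src))⁻¹) (fun b => inv_mul_cancel₀ (Real.exp_pos _).ne') Mf Mfi hMf hMfi
  -- the discharged letters: δ₁ = δ₂ (Q_k weight conjugation), C_Q (adjoint norm), the adjunction and `KK⁻¹ = 1`
  obtain ⟨hA, hC⟩ := qkWeightConj_letters_exp_corner_of_regPr F h c₀ cB hε₀ hε hε12 U₀ hreg φ hμ hφ' M Mi hM hMi Mf Mfi hMf hMfi
  have hQadj := norm_adjoint_Qk_le_of_regPr F c₀ cB h hε₀ hε hε12 U₀ hreg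
  have hadj : ∀ (x : BondL2K ℂ 3 (periodsT3 F K) c₀ W₂) (c : WL2 ℂ (fun _ : PBond (F.P n) 0 => cB) W₂),
      ⟪Qk F n K h c₀ cB U₀ x, c⟫_ℂ = ⟪x, LinearMap.adjoint (Qk F n K h c₀ cB U₀) c⟫_ℂ := fun x c => (LinearMap.adjoint_inner_right _ x c).symm
  have hB := hres φ hφ' Mf Mfi hMf hMfi
  -- conjugated accretivity with constant `m₀ − R ≥ m₀∕2`
  have hacc0 := conj_accretive_of_letters (Qk F n K h c₀ cB U₀) (LinearMap.adjoint (Qk F n K h c₀ cB U₀)) hadj (GT F n K h c₀ cB a Δx U₀)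
    M Mi hMiM Mf Mfi hMfiMf hCQ0 hBG hδQ0 hδ₃ hKco hQadj hG hA hB hC
  have hm2 : 0 < m₀ / 2 := by linarith
  have hacc : ∀ u, (m₀ / 2) * ‖M u‖ ^ 2 ≤ RCLike.re ⟪M u, M ((Qk F n K h c₀ cB U₀ ∘ₗ GT F n K h c₀ cB a Δx U₀ ∘ₗ LinearMap.adjoint (Qk F n K h c₀ cB U₀)) u)⟫_ℂ := by
    intro u
    have h1 := hacc0 u
    have h2 : (m₀ / 2) * ‖M u‖ ^ 2 ≤ (m₀ - (CQ * BG * δQ + CQ * δ₃ * (CQ + δQ) + δQ * (BG + δ₃) * (CQ + δQ))) * ‖M u‖ ^ 2 :=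
      mul_le_mul_of_nonneg_right (by linarith) (sq_nonneg _)
    simpa only [LinearMap.comp_apply] using h2.trans h1
  have hKK : ∀ v, (Qk F n K h c₀ cB U₀ ∘ₗ GT F n K h c₀ cB a Δx U₀ ∘ₗ LinearMap.adjoint (Qk F n K h c₀ cB U₀)) (KinvT F n K h c₀ cB a Δx U₀ v) = v := fun v => by
    simpa only [LinearMap.comp_apply] using Qk_GT_adjoint_KinvT hp v
  -- the engine: spike at `y`, read at `y′`
  have hent := norm_symm_Kinv_single_le_of_conj_accretive _ (KinvT F n K h c₀ cB a Δx U₀) hKK w hw M hM hm2 hacc y' y Z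
  -- the weight ratio `w y ∕ w y′ ≤ e^{3μ}·e^{−μ·tdist(ŷ′, ŷ)}` (read at the corners)
  obtain ⟨hwy0, hwy1⟩ := exp_weight_rows F h φ y hφy hφz
  have hwy : w y = 1 := hwy0 (xr y) (iterBlockOf_src_corner F h y)
  have hwy' : Real.exp (-(3 * μ)) * Real.exp (μ * (Site.tdist (P := F.P K) (siteShift (sites_eq F n K h) y'.src) (siteShift (sites_eq F n K h) y.src) : ℝ))
      ≤ w y' := hwy1 y' (xr y') (iterBlockOf_src_corner F h y')
  have hratio : w y / w y' ≤ Real.exp (3 * μ)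
      * Real.exp (-(μ * (Site.tdist (P := F.P K) (siteShift (sites_eq F n K h) y'.src) (siteShift (sites_eq F n K h) y.src) : ℝ))) := by
    rw [hwy, div_le_iff₀ (hw y')]
    have e3 : Real.exp (3 * μ) * Real.exp (-(3 * μ)) = 1 := by rw [← Real.exp_add]; simp
    have et : Real.exp (-(μ * (Site.tdist (P := F.P K) (siteShift (sites_eq F n K h) y'.src) (siteShift (sites_eq F n K h) y.src) : ℝ)))
        * Real.exp (μ * (Site.tdist (P := F.P K) (siteShift (sites_eq F n K h) y'.src) (siteShift (sites_eq F n K h) y.src) : ℝ)) = 1 := by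
      rw [← Real.exp_add]; simp
    calc (1 : ℝ) = (Real.exp (3 * μ) * Real.exp (-(μ * (Site.tdist (P := F.P K) (siteShift (sites_eq F n K h) y'.src) (siteShift (sites_eq F n K h) y.src) : ℝ))))
          * (Real.exp (-(3 * μ)) * Real.exp (μ * (Site.tdist (P := F.P K) (siteShift (sites_eq F n K h) y'.src) (siteShift (sites_eq F n K h) y.src) : ℝ))) := by
            nlinarith [e3, et]
      _ ≤ (Real.exp (3 * μ) * Real.exp (-(μ * (Site.tdist (P := F.P K) (siteShift (sites_eq F n K h) y'.src) (siteShift (sites_eq F n K h) y.src) : ℝ))))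
          * w y' := mul_le_mul_of_nonneg_left hwy' (by positivity)
  calc ‖(toL2B F n cB).symm (KinvT F n K h c₀ cB a Δx U₀ (toL2B F n cB (Pi.single y Z))) y'‖
      ≤ Real.sqrt 2 * (m₀ / 2)⁻¹ * (w y / w y') * ‖Z‖ := hent
    _ ≤ Real.sqrt 2 * (m₀ / 2)⁻¹ * (Real.exp (3 * μ)
          * Real.exp (-(μ * (Site.tdist (P := F.P K) (siteShift (sites_eq F n K h) y'.src) (siteShift (sites_eq F n K h) y.src) : ℝ)))) * ‖Z‖ :=
        mul_le_mul_of_nonneg_right (mul_le_mul_of_nonneg_left hratio (by positivity)) (norm_nonneg _)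
    _ = _ := by ring

/-! ## §3 (v1.1, append) ★★★ The Idx edition: L-only letters, the scaling of record, the homogeneous window -/

section Family

/-- ★★★ **THE `hKinv` FAMILY FROM L-ONLY LETTERS** (Idx edition of §2).  Cap `α` with the windows of record; L-only weights `c₀ cB`; member coupling `a L i`; slots `Δx L i`; ANY thread `Λ L i U₀`
(S47: Lift).  DISPLAYED FAMILY LETTERS under `RegPr ρ U₀ → ρ ≤ α L → Λ →`: `hpos` (the class), (m₀) the coercivity of `K` IN THE SCALING OF RECORD `m₀ L·((cB L∕c₀ L)·ℓ⁻³)` (`K = Q_kGQ_k†` carries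
`Q_k†`'s `(cB∕c₀)ℓ⁻³`; `m₀ L` K-free = (K1)'s `(4C₀)⁻¹` at the pins), (B_G) `‖G‖ ≤ BG L` (L-only: `(γco L)⁻¹` by ✓`norm_GT_le_of_coercive`), (δ₃) the phase-class row with an L-only `δ₃ L` at
slope `μ L·η`, and ONE L-ONLY WINDOW (R_L) `6·BG·δ̂ + 6·δ₃·(6 + δ̂) + δ̂·(BG + δ₃)·(6 + δ̂) ≤ m₀∕2` with `δ̂ L := √216·(e^{4μ L} − 1)` — the member window (R) divided by its homogeneity
factor `s = (cB∕c₀)ℓ⁻³` (`C_Q = 6√s`, `δ_Q = δ̂√s`, `m₀ = m₀ L·s`).  CONCLUSION: the `hKinv` FAMILY TEXT of the doors (✓`kernelC_family_of_kinvRow_of_greenColumn`, ✓`kernel137_family_of_kinvRow`,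
✓`kernel133_family_of_kinvRow_of_greenBlockSup`) with `CK L := 2√2·e^{3μ L}∕m₀ L` at the scaling `(c₀ L∕cB L)·ℓ³` and rate `μ L`.
[cite: Balaban1985BackgroundPropagators, (3.132) p.422, Thm 3.1 (3.46) p.398, (3.49) p.399, (3.16) p.393; Balaban1984PropagatorsII, §2] -/
theorem kinvRow_family_of_coercive_of_conjResolvent
    (α : ℕ → ℝ) (hα : ∀ L : ℕ, 1 < L → 0 < α L) (hW : ∀ L : ℕ, 1 < L → 10 ^ 10 * (L : ℝ) ^ 6 * α L ≤ 1) (hW' : ∀ L : ℕ, 1 < L → 10 ^ 12 * (L : ℝ) ^ 3 * α L ≤ 1)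
    (c₀ cB : ℕ → ℝ) [hc₀ : ∀ L : ℕ, Fact (0 < c₀ L)] [hcB : ∀ L : ℕ, Fact (0 < cB L)] (a : ∀ L : ℕ, T3Thm1Carrier.Idx L → ℝ)
    (Δx : ∀ (L : ℕ) (i : T3Thm1Carrier.Idx L), GaugeField (i.1.1.P i.1.2.2) 0 (Matrix.specialUnitaryGroup (Fin 2) ℂ) →
      (BondL2K ℂ 3 (periodsT3 i.1.1 i.1.2.2) (c₀ L) W₂ →ₗ[ℂ] BondL2K ℂ 3 (periodsT3 i.1.1 i.1.2.2) (c₀ L) W₂))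
    (Λ : ∀ (L : ℕ) (i : T3Thm1Carrier.Idx L), GaugeField (i.1.1.P i.1.2.2) 0 (Matrix.specialUnitaryGroup (Fin 2) ℂ) → Prop)
    (m₀ BG μ δ₃ : ℕ → ℝ) (hm₀ : ∀ L, 1 < L → 0 < m₀ L) (hBG : ∀ L, 1 < L → 0 ≤ BG L) (hμ : ∀ L, 1 < L → 0 ≤ μ L) (hδ₃ : ∀ L, 1 < L → 0 ≤ δ₃ L)
    (hpos : ∀ (L : ℕ), 1 < L → ∀ (i : T3Thm1Carrier.Idx L) (U₀ : GaugeField (i.1.1.P i.1.2.2) 0 (Matrix.specialUnitaryGroup (Fin 2) ℂ)), ∀ ρ : ℝ,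
      RegPr i.1.1 i.1.2.1 i.1.2.2 ρ U₀ → ρ ≤ α L → Λ L i U₀ → PosOnto i.1.1 i.1.2.1 i.1.2.2 i.2.2.le (c₀ L) (cB L) (a L i) (Δx L i) U₀)
    (hKco : ∀ (L : ℕ), 1 < L → ∀ (i : T3Thm1Carrier.Idx L) (U₀ : GaugeField (i.1.1.P i.1.2.2) 0 (Matrix.specialUnitaryGroup (Fin 2) ℂ)), ∀ ρ : ℝ,
      RegPr i.1.1 i.1.2.1 i.1.2.2 ρ U₀ → ρ ≤ α L → Λ L i U₀ → ∀ c : WL2 ℂ (fun _ : PBond (i.1.1.P i.1.2.1) 0 => cB L) W₂,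
        m₀ L * ((cB L / c₀ L) * ((L : ℝ) ^ (i.1.2.2 - i.1.2.1))⁻¹ ^ 3) * ‖c‖ ^ 2
          ≤ RCLike.re ⟪c, Qk i.1.1 i.1.2.1 i.1.2.2 i.2.2.le (c₀ L) (cB L) U₀ (GT i.1.1 i.1.2.1 i.1.2.2 i.2.2.le (c₀ L) (cB L) (a L i) (Δx L i) U₀
            (LinearMap.adjoint (Qk i.1.1 i.1.2.1 i.1.2.2 i.2.2.le (c₀ L) (cB L) U₀) c))⟫_ℂ)
    (hG : ∀ (L : ℕ), 1 < L → ∀ (i : T3Thm1Carrier.Idx L) (U₀ : GaugeField (i.1.1.P i.1.2.2) 0 (Matrix.specialUnitaryGroup (Fin 2) ℂ)), ∀ ρ : ℝ,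
      RegPr i.1.1 i.1.2.1 i.1.2.2 ρ U₀ → ρ ≤ α L → Λ L i U₀ → ∀ x, ‖GT i.1.1 i.1.2.1 i.1.2.2 i.2.2.le (c₀ L) (cB L) (a L i) (Δx L i) U₀ x‖ ≤ BG L * ‖x‖)
    (hres : ∀ (L : ℕ), 1 < L → ∀ (i : T3Thm1Carrier.Idx L) (U₀ : GaugeField (i.1.1.P i.1.2.2) 0 (Matrix.specialUnitaryGroup (Fin 2) ℂ)), ∀ ρ : ℝ,
      RegPr i.1.1 i.1.2.1 i.1.2.2 ρ U₀ → ρ ≤ α L → Λ L i U₀ →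
      ∀ φ : Site (i.1.1.P i.1.2.2) 0 → ℝ, (∀ x x' : Site (i.1.1.P i.1.2.2) 0, |φ x - φ x'| ≤ μ L * eta i.1.1 i.1.2.1 i.1.2.2 * (Site.tdist x x' : ℝ)) →
      ∀ (Mf Mfi : BondL2K ℂ 3 (periodsT3 i.1.1 i.1.2.2) (c₀ L) W₂ →ₗ[ℂ] BondL2K ℂ 3 (periodsT3 i.1.1 i.1.2.2) (c₀ L) W₂),
        (∀ X, Mf (toL2 i.1.1 i.1.2.2 (c₀ L) X) = toL2 i.1.1 i.1.2.2 (c₀ L) (fun b => Real.exp (φ b.src) • X b)) →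
        (∀ X, Mfi (toL2 i.1.1 i.1.2.2 (c₀ L) X) = toL2 i.1.1 i.1.2.2 (c₀ L) (fun b => (Real.exp (φ b.src))⁻¹ • X b)) →
        ∀ x, ‖Mf (GT i.1.1 i.1.2.1 i.1.2.2 i.2.2.le (c₀ L) (cB L) (a L i) (Δx L i) U₀ (Mfi x)) - GT i.1.1 i.1.2.1 i.1.2.2 i.2.2.le (c₀ L) (cB L) (a L i) (Δx L i) U₀ x‖ ≤ δ₃ L * ‖x‖)
    (hR : ∀ L, 1 < L → 6 * BG L * (Real.sqrt 216 * (Real.exp (μ L * (3 + 1)) - 1)) + 6 * δ₃ L * (6 + Real.sqrt 216 * (Real.exp (μ L * (3 + 1)) - 1))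
      + (Real.sqrt 216 * (Real.exp (μ L * (3 + 1)) - 1)) * (BG L + δ₃ L) * (6 + Real.sqrt 216 * (Real.exp (μ L * (3 + 1)) - 1)) ≤ m₀ L / 2) :
    ∀ (L : ℕ), 1 < L → ∀ (i : T3Thm1Carrier.Idx L) (U₀ : GaugeField (i.1.1.P i.1.2.2) 0 (Matrix.specialUnitaryGroup (Fin 2) ℂ)), ∀ ρ : ℝ,
      RegPr i.1.1 i.1.2.1 i.1.2.2 ρ U₀ → ρ ≤ α L → Λ L i U₀ →
      ∀ (y : PBond (i.1.1.P i.1.2.1) 0) (Z : Matrix (Fin 2) (Fin 2) ℂ) (y' : PBond (i.1.1.P i.1.2.1) 0),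
        ‖(toL2B i.1.1 i.1.2.1 (cB L)).symm (KinvT i.1.1 i.1.2.1 i.1.2.2 i.2.2.le (c₀ L) (cB L) (a L i) (Δx L i) U₀ (toL2B i.1.1 i.1.2.1 (cB L) (Pi.single y Z))) y'‖
          ≤ (2 * Real.sqrt 2 * Real.exp (3 * μ L) / m₀ L) * ((c₀ L / cB L) * ((L : ℝ) ^ (i.1.2.2 - i.1.2.1)) ^ 3)
              * Real.exp (-(μ L * (Site.tdist (siteShift (sites_eq i.1.1 i.1.2.1 i.1.2.2 i.2.2.le) y'.src) (siteShift (sites_eq i.1.1 i.1.2.1 i.1.2.2 i.2.2.le) y.src) : ℝ))) * ‖Z‖ := by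
  intro L hL i U₀ ρ hreg hρ hl y Z y'
  have hFL : (i.1.1.L : ℝ) = (L : ℝ) := by rw [i.2.1]
  have hd : ((i.1.1.P i.1.2.2).d : ℝ) = 3 := by rw [show (i.1.1.P i.1.2.2).d = 3 from rfl]; norm_num
  have hc₀L : 0 < c₀ L := (hc₀ L).out
  have hcBL : 0 < cB L := (hcB L).out
  have hL0 : (0 : ℝ) < (L : ℝ) := by exact_mod_cast lt_trans zero_lt_one hL
  have hℓ : (0 : ℝ) < (L : ℝ) ^ (i.1.2.2 - i.1.2.1) := pow_pos hL0 _
  -- the homogeneity factor `s = (cB∕c₀)ℓ⁻³` and the member letters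
  set s : ℝ := (cB L / c₀ L) * ((L : ℝ) ^ (i.1.2.2 - i.1.2.1))⁻¹ ^ 3 with hs
  have hs0 : 0 < s := by rw [hs]; positivity
  have hregα : RegPr i.1.1 i.1.2.1 i.1.2.2 (α L) U₀ := T3PrintedMinimiserExistence.regPr_mono (F := i.1.1) hρ hreg
  have hεw : 10 ^ 10 * (i.1.1.L : ℝ) ^ 6 * α L ≤ 1 := by rw [hFL]; exact hW L hL
  have hεw' : 10 ^ 12 * (i.1.1.L : ℝ) ^ 3 * α L ≤ 1 := by rw [hFL]; exact hW' L hL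
  have hm₀s : 0 < m₀ L * s := mul_pos (hm₀ L hL) hs0
  -- the two discharged constants ARE `6√s` and `δ̂√s`
  have hCQ : 6 * Real.sqrt (cB L / c₀ L) * Real.sqrt (((i.1.1.L : ℝ) ^ (i.1.2.2 - i.1.2.1))⁻¹ ^ 3) = 6 * Real.sqrt s := by
    rw [hFL, hs, mul_assoc, ← Real.sqrt_mul (div_nonneg hcBL.le hc₀L.le)]
  have hδQ : Real.sqrt (216 * (Real.exp (μ L * ((i.1.1.P i.1.2.2).d + 1)) - 1) ^ 2 * (cB L / (c₀ L * ((i.1.1.L : ℝ) ^ (i.1.2.2 - i.1.2.1)) ^ 3)))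
      = Real.sqrt 216 * (Real.exp (μ L * (3 + 1)) - 1) * Real.sqrt s := by
    have he : 0 ≤ Real.exp (μ L * (3 + 1)) - 1 := by
      have : 0 ≤ μ L * (3 + 1) := by have := hμ L hL; positivity
      linarith [Real.one_le_exp this]
    rw [hd, hFL, show cB L / (c₀ L * ((L : ℝ) ^ (i.1.2.2 - i.1.2.1)) ^ 3) = s by rw [hs, inv_pow, div_mul_eq_div_div]; ring,
      Real.sqrt_mul (by positivity), Real.sqrt_mul (by positivity), Real.sqrt_sq he]
  -- the member window (R) = s · (R_L)
  have hRm := hR L hL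
  have hmem := kinvRow_of_coercive_of_conjResolvent i.1.1 i.2.2.le (c₀ L) (cB L) (hα L hL) hεw hεw' U₀ hregα (a L i) (Δx L i) (hpos L hL i U₀ ρ hreg hρ hl)
    hm₀s (hBG L hL) (hμ L hL) (hδ₃ L hL) (hKco L hL i U₀ ρ hreg hρ hl) (hG L hL i U₀ ρ hreg hρ hl) (hres L hL i U₀ ρ hreg hρ hl)
    (by
      rw [hCQ, hδQ]
      have hss : Real.sqrt s * Real.sqrt s = s := Real.mul_self_sqrt hs0.le
      have key : 6 * Real.sqrt s * BG L * (Real.sqrt 216 * (Real.exp (μ L * (3 + 1)) - 1) * Real.sqrt s)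
          + 6 * Real.sqrt s * δ₃ L * (6 * Real.sqrt s + Real.sqrt 216 * (Real.exp (μ L * (3 + 1)) - 1) * Real.sqrt s)
          + Real.sqrt 216 * (Real.exp (μ L * (3 + 1)) - 1) * Real.sqrt s * (BG L + δ₃ L) * (6 * Real.sqrt s + Real.sqrt 216 * (Real.exp (μ L * (3 + 1)) - 1) * Real.sqrt s)
          = s * (6 * BG L * (Real.sqrt 216 * (Real.exp (μ L * (3 + 1)) - 1)) + 6 * δ₃ L * (6 + Real.sqrt 216 * (Real.exp (μ L * (3 + 1)) - 1))
              + (Real.sqrt 216 * (Real.exp (μ L * (3 + 1)) - 1)) * (BG L + δ₃ L) * (6 + Real.sqrt 216 * (Real.exp (μ L * (3 + 1)) - 1))) := by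
        linear_combination (6 * BG L * (Real.sqrt 216 * (Real.exp (μ L * (3 + 1)) - 1)) + 6 * δ₃ L * (6 + Real.sqrt 216 * (Real.exp (μ L * (3 + 1)) - 1))
          + (Real.sqrt 216 * (Real.exp (μ L * (3 + 1)) - 1)) * (BG L + δ₃ L) * (6 + Real.sqrt 216 * (Real.exp (μ L * (3 + 1)) - 1))) * hss
      rw [key]
      calc _ ≤ s * (m₀ L / 2) := mul_le_mul_of_nonneg_left hRm hs0.le
        _ = m₀ L * s / 2 := by ring) y Z y'
  refine hmem.trans (le_of_eq ?_)
  congr 1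
  congr 1
  rw [hs]
  field_simp

end Family

end Summit.QuantumFields.YangMills.Theorems.Prop7KinvRowOfConjLetters

end
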